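import Literature.MathematicalPhysics.QuantumFieldTheory.Balaban1983to89.B6Prop27KLevelV1L0
import Literature.MathematicalPhysics.QuantumFieldTheory.Balaban1983to89.B6Ineq2142KLevelV1L3
import HarnessLib

/-!
# `Balaban1983to89.B6Prop27KLevelV1L3` — SUB-ROW G-F3′-L0∕L3 (every odd `L ≥ 3`; plan `lit-balaban-r03/G-F3L0-PLAN.md` §13 cure (B′), joints J9′–J14): the L = 3 twin of
`B6Prop27KLevelV1L0` — ONLY its window-dependent assembly theorem is re-declared (joint J14: every window-free declaration of the level-0 twin is consumed BY NAME),
re-proved verbatim over the L3 parents (canonical chart `B6CubeWindowV1L3`, placement predicate `PlacedC`, the binder `4 ≤ ℓ` DROPPED, `R ≥ 2L²` KEPT).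
T. Bałaban, *Propagators and renormalization transformations for lattice gauge theories. II*, Commun. Math. Phys. **96** (1984) 223–250 [Balaban1984PropagatorsII].
No `def … : Prop`, no new fact; standard axioms.  Unit `lit-balaban-r03` (B6 fold owner, r03 gen 37), 2026-08-27; referee ref-4.  NOT summit progress.

statement-level skeleton of published theorems with citation tags; proofs where landed; nothing here is a claim about the Yang–Mills mass gap
-/

namespace Literature.MathematicalPhysics.QuantumFieldTheory.Balaban1983to89.B6Prop27KLevelV1L3

open LatticeFieldCalculus
open scoped InnerProductSpace
open B5Eq118OneStroke (iterBlockOf)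
open B6LowerBound2153Torus (rep)
open B5Eq117TorusCarriers (Mk)
open B6MultiLevelBoxOperator (N0)
open B6MultiLevelBoxOperatorL0 (Domains)
open B6MultiLevelTorusOperatorL0 (TDomains)
open B6Geom246MultiLevelBoxL0 (bset blkOf blkOf_val)
open B6Geom246MultiLevelTorusL0 (geomT bondT lemma21_torus)
open B6Lemma21Repaired (Ineq261With)
open B6Ineq261LevelGap (K261 K261_nonneg)
open B6Ineq281MultiLevelBox (Kprof)
open B6GlobalChartV1 (PV toBox blk_toBox)
open B6GlobalChartV1L0 (domT blkV1)
open B6RandomWalk (delta3)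
open B6SectAOperatorsV1 (QE QsE aE aE_apply inner_aE_left BondIdx BondIdxSpace inner_QsE_left)
open B6SectAVectorModelV1 (GE EE inner_GE_left comp_EE EE_comp)
open B6Prop23MultiLevelTorusL0 (isPseudoDist_distT sumBound_torus)
open B4Sect5Torus (IsPseudoDist SumBound Hyp56 rate rate_pos)
open B6Ineq2148TwoScaleV1 (inverse_entry_decay)
open B6Ineq2142KLevelV1 (one_le_lvl shift_injective)
open B6Ineq2142KLevelV1L0 (lvl lvl_le_mK base baseSite iterBlockOf_baseSite β beta_level X X_eq_inner X_symm)
open B6CubeWindowV1 (Placed GlobalBand)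
open B6Cover236MultiLevelBlocksL0 (cubes)
open B6CubeWindowV1L3 (PlacedC)
open Literature.MathematicalPhysics.QuantumFieldTheory.Balaban1983to89.B6Prop27KLevelV1L0 (wt lam prop27_kLevel_of_coercive rate_eq)

noncomputable section

variable {d ℓ m K : ℕ} {hd : 1 ≤ d + 1} {hL : Odd (ℓ + 1) ∧ 1 < ℓ + 1}
variable {Mh k R : ℕ} {P' : Fin (d + 1) → ℕ}

/-- **[B6] PROPOSITION 2.7 (2.149) AT k LEVELS FOR THE GENUINE `(QGQ*)⁻¹ = EE (domT hN D hk)`, MODULO THE LEVEL-WEIGHTED (2.147)**: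
(2.142) discharged by `B6Ineq2142KLevelV1L3.ineq2142_kLevel` (ROUTE V setting: `k ≥ 2`, `M_h = L^a ≥ 8`, `M₂ ≤ L·M_h`, `R ≥ 2L²`, `P′ ≥ 5`, `L ≥ 5`,
`Placed`, weights in the band (2.16)) and the profile of Lemma 2.1 discharged by `lemma21_torus` («for M large enough»: `N₁ + 1 ≤ R·L·M_h`):
there are `σ₁ > 0` and, for every `σ ∈ (0, σ₁]`, `α ∈ (0, 1)`, constants `A′ > 0`, `M₂ > 0`, `N₁`, `c ≥ 0` such that for every such torus,
EVERY `γ > 0` with `γΣ_iΛ_i²v_i² ≤ ⟪Q*v, GQ*v⟫` for all `v`, and ALL index bonds `i, i′`: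
`|⟪e_i, (QGQ*)⁻¹e_{i′}⟫| ≤ Λ_i⁻¹Λ_{i′}⁻¹·(2/γ)·e^{−δ₄ d_T(β i, β i′)}`, `δ₄ = min(δ₃/4, (γ/A′)/(16D·c/δ₃ + 1)) > 0`, `δ₃ = delta3 α (2σ)`.
[cite: Balaban1984PropagatorsII, Prop. 2.7 (2.149) p.249, (2.142)–(2.148) p.248; Balaban1983RegularityDecay, Sect. 5 (5.7) p.594] -/
theorem prop27_kLevel (d ℓ : ℕ) (hd : 1 ≤ d + 1) (hL : Odd (ℓ + 1) ∧ 1 < ℓ + 1) {b₀ b₁ : ℝ} (hb₀ : 0 < b₀) (hb₁ : b₀ ≤ b₁) :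
    ∃ σ₁ : ℝ, 0 < σ₁ ∧ ∀ (σ : ℝ), 0 < σ → σ ≤ σ₁ → ∀ (α : ℝ), 0 < α → α < 1 →
    ∃ (A' M₂ c : ℝ) (N₁ : ℕ), 0 < A' ∧ 0 < M₂ ∧ 0 ≤ c ∧
    ∀ (m K : ℕ) {Mh k R : ℕ} {P' : Fin (d + 1) → ℕ}
      (hN : ∀ μ, N0 ℓ Mh k P' μ = (PV d ℓ m K hd hL).sitesPerDir 0) (D : TDomains d ℓ Mh k P' R) (hk : k ≤ m + K) (_ : 2 ≤ k)
      {a : ℕ} (_ : Mh = (ℓ + 1) ^ a) (_ : 8 ≤ Mh) (_ : 2 * (ℓ + 1) ^ 2 ≤ R) (_ : ∀ μ, 5 ≤ P' μ)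
      (_ : ∀ c : ↥(cubes D.toDomains), PlacedC ℓ k P' c.1) (_ : M₂ ≤ ((ℓ : ℝ) + 1) * Mh) (_ : N₁ + 1 ≤ R * ((ℓ + 1) * Mh))
      {cf : ℝ} (hcf : cf ≠ 0) {w : BondIdx (domT hN D hk) → ℝ} (hw : ∀ i, 0 < w i) (_ : GlobalBand b₀ b₁ cf w)
      {γ : ℝ} (_ : 0 < γ)
      (_ : ∀ v : BondIdxSpace (domT hN D hk), γ * ∑ i, wt hN D hk cf i * v i ^ 2 ≤
        ⟪QsE (domT hN D hk) v, GE (domT hN D hk) hcf hw (QsE (domT hN D hk) v)⟫_ℝ),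
      ∀ i i' : BondIdx (domT hN D hk),
        |⟪EuclideanSpace.single i (1 : ℝ), EE (domT hN D hk) hcf hw (EuclideanSpace.single i' (1 : ℝ))⟫_ℝ| ≤
          (lam hN D hk cf i)⁻¹ * (lam hN D hk cf i')⁻¹ * (2 / γ *
            Real.exp (-(min (delta3 α (2 * σ) / 4) (γ / A' / (2 * (1 * (4 / delta3 α (2 * σ)) * (2 * ((d : ℝ) + 1) * c)) + 1)) *
              (geomT D).dist (β hN D hk i) (β hN D hk i')))) := by
  obtain ⟨σ₁, hσ₁, h⟩ := B6Ineq2142KLevelV1L3.ineq2142_kLevel d ℓ hd hL hb₀ hb₁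
  refine ⟨σ₁, hσ₁, fun σ hσ hσ1 α hα hα1 => ?_⟩
  obtain ⟨A₀, M₂, hA₀, hM₂, h2142⟩ := h σ hσ hσ1 α hα hα1.le
  -- a positive constant and the decay rate `δ₃ > 0` (`α < 1`)
  set A' : ℝ := A₀ + 1 with hA'
  have hA'0 : 0 < A' := by rw [hA']; linarith
  set δ : ℝ := delta3 α (2 * σ) with hδdef
  have hδ : 0 < δ := B6RandomWalk.delta3_pos hα1 (by linarith)
  -- the threshold of Lemma 2.1 on the torus at `α = 1/16`, `δ₀ = 8δ`
  have hL0 : (0 : ℝ) < (ℓ : ℝ) + 1 := by positivity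
  have hlog : Real.log ((ℓ : ℝ) + 1) ≤ (ℓ : ℝ) + 1 := (Real.log_le_sub_one_of_pos hL0).trans (by linarith)
  obtain ⟨N₁, hN₁⟩ : ∃ N₁ : ℕ, N₁ = ⌈4 * ((d : ℝ) + 1) * ((ℓ : ℝ) + 1) / δ⌉₊ + 1 := ⟨_, rfl⟩
  have hN₁pos : 0 < N₁ := by rw [hN₁]; omega
  have hN₁ge : 4 * ((d : ℝ) + 1) * ((ℓ : ℝ) + 1) < δ * (N₁ : ℝ) := by
    have h1 : 4 * ((d : ℝ) + 1) * ((ℓ : ℝ) + 1) / δ < (N₁ : ℝ) := by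
      rw [hN₁]; push_cast; exact lt_of_le_of_lt (Nat.le_ceil _) (by linarith)
    rw [div_lt_iff₀ hδ] at h1; linarith
  have hθ : Real.exp (-(1 / 16 * (8 * δ))) * ((ℓ : ℝ) + 1) ^ ((2 * (d + 1 : ℕ) : ℝ) / N₁) < 1 := by
    refine B6Ineq261LevelGap.theta_lt_one_of_log hL0 hN₁pos ?_
    push_cast
    have hd0 : (0 : ℝ) ≤ 2 * ((d : ℝ) + 1) := by positivity
    nlinarith [mul_le_mul_of_nonneg_left hlog hd0]
  set c16 : ℝ := K261 N₁ (d + 1) ((ℓ : ℝ) + 1) 1 (1 / 16 * (8 * δ)) with hc16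
  have hc16_0 : 0 ≤ c16 := K261_nonneg (by positivity) zero_le_one
  refine ⟨A', M₂, c16, N₁, hA'0, hM₂, hc16_0, ?_⟩
  intro m K Mh k R P' hN D hk hk2 a hMha hM8 hR2 hP5 hpl hM hRM cf hcf w hw hwb γ hγ0 hγ i i'
  have hMh : 1 ≤ Mh := le_trans (by norm_num) hM8
  have hP : ∀ μ, 1 ≤ P' μ := fun μ => le_trans (by norm_num) (hP5 μ)
  -- (2.142) with the constant `A′ = A₀ + 1 > 0`
  have h2142' : ∀ i i' : BondIdx (domT hN D hk), |X hN D hk hcf hw i i'| ≤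
      A' * ((((ℓ + 1 : ℕ) : ℝ)) ^ (lvl hN D hk i) / cf) ^ 2 * ((((ℓ + 1 : ℕ) : ℝ) ^ (d + 1)) ^ (lvl hN D hk i'))⁻¹ *
        Real.exp (-(δ * (geomT D).dist (β hN D hk i) (β hN D hk i'))) := fun i i' =>
    (h2142 m K hN D hk hk2 hMha hM8 hR2 hP5 hpl hM hcf hw hwb i i').trans (by
      apply mul_le_mul_of_nonneg_right _ (Real.exp_pos _).le
      apply mul_le_mul_of_nonneg_right _ (by positivity)
      apply mul_le_mul_of_nonneg_right _ (sq_nonneg _)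
      rw [hA']; linarith)
  -- Lemma 2.1 on the torus
  obtain ⟨-, h261, -, -⟩ := lemma21_torus D hMh hP hN₁pos hRM (δ₀ := 8 * δ) (α := 1 / 16) (by linarith) (by norm_num) (by norm_num) hθ
  have h := prop27_kLevel_of_coercive hN D hk hcf hw hMh hP hA'0 hδ hγ0 hc16_0 h261 h2142' hγ i i'
  rwa [rate_eq D] at h


end

end Literature.MathematicalPhysics.QuantumFieldTheory.Balaban1983to89.B6Prop27KLevelV1L3
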